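import Mathlib.Data.Fintype.Sort
import Literature.Computability.AlgebraicComplexity.ArithCircuitProofs
import Literature.Computability.AlgebraicComplexity.ConstantFreeCircuits
import Literature.Computability.AlgebraicComplexity.ArithCircuitChain
import Literature.Computability.AlgebraicComplexity.ArithCircuitWeightedSums
import HarnessLib

/-!
# Jointly computed families: the multi-output cost calculus of `complexity`

Topic `Computability/AlgebraicComplexity`, namespace `Literature.Computability.AlgebraicComplexity`.
Everything PROVED; one new definition (`JointlyComputed`), no named facts.

The tree's `complexity` (`ArithCircuit.lean`, Bürgisser 2000, Def. 2.1) is a single-output measure,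
and `complexity_chain_le` (`ArithCircuitChain.lean`) prices ONE table given as a whole.  Fast
algorithms (FFT, product trees, Newton iterations) are composed from multi-output stages; to price
them modularly this file isolates the invariant of the proof of `complexity_chain_le` as a
predicate and gives it a calculus (Bürgisser 2000, proof of Prop. 2.3 / Rem. 2.7, "a straight-line
program computes all its intermediate results"):

* `JointlyComputed v s` — the family `v : ι → k[X_τ]` is read off ONE fan-in-two gate list of
  length `≤ s` by stable operands (stable: correct whatever is appended later);
* inputs are free (`jointlyComputed_of_inputs`), sub-families / duplicates / added inputs are free
  (`JointlyComputed.of_mem`, `.precomp`), monotone in `s` (`.mono`);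
* `JointlyComputed.complexity_le` — every member has `complexity ≤ s`;
* `JointlyComputed.extend₁` / `.extend` — appending one new entry `F(X, v)` costs `complexity F`,
  appending a finite family of such entries (each reading only `v`) costs the sum;
* one-gate steps: `extend_wadd` (`a • v i + b • v j`), `extend_mul` (`v i * v j`), `extend_smul`
  (`a • v i`) cost one gate per new entry (`complexity_wadd_le`, `ArithCircuitWeightedSums.lean`).

## References

* [Burgisser2000] P. Bürgisser, *Completeness and Reduction in Algebraic Complexity Theory*,
  Springer 2000, Def. 2.1, proof of Prop. 2.3, Rem. 2.7.
-/

noncomputable section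

open MvPolynomial

namespace Literature.Computability.AlgebraicComplexity

universe u v w w'

variable {k : Type u} [CommSemiring k] {τ : Type v}

open ArithCircuit

/-- **Jointly computed family.** `JointlyComputed v s`: there is ONE fan-in-two gate list of length
at most `s` off which every member `v i` of the family is read by a stable operand — an operand
whose value is `v i` against the gate values followed by anything appended later (Bürgisser 2000,
proof of Prop. 2.3: intermediate results of a straight-line program). [cite: Burgisser2000, Rem. 2.7] -/
def JointlyComputed {ι : Type w} (v : ι → MvPolynomial τ k) (s : ℕ) : Prop :=
  ∃ G : List (Gate k τ), (∀ g ∈ G, g.fanIn ≤ 2) ∧ G.length ≤ s ∧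
    ∀ i, ∃ o : Operand k τ, ∀ ws, o.eval (gateValues G ++ ws) = v i

namespace JointlyComputed

variable {ι : Type w} {ι' : Type w'} {v : ι → MvPolynomial τ k} {s : ℕ}

/-- Monotonicity in the size bound. [cite: Burgisser2000, Def. 2.1] -/
theorem mono (h : JointlyComputed v s) {s' : ℕ} (hs : s ≤ s') : JointlyComputed v s' := by
  obtain ⟨G, hfan, hlen, hval⟩ := h
  exact ⟨G, hfan, hlen.trans hs, hval⟩

/-- **Sub-families, duplicates and added inputs are free**: a family each of whose members is a
member of a jointly computed family, a variable, or a constant is jointly computed within the same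
size. [cite: Burgisser2000, Def. 2.1] -/
theorem of_mem (h : JointlyComputed v s) (w : ι' → MvPolynomial τ k)
    (hw : ∀ i', (∃ i, w i' = v i) ∨ (∃ x, w i' = X x) ∨ ∃ c, w i' = C c) :
    JointlyComputed w s := by
  obtain ⟨G, hfan, hlen, hval⟩ := h
  refine ⟨G, hfan, hlen, fun i' => ?_⟩
  rcases hw i' with ⟨i, hi⟩ | ⟨x, hx⟩ | ⟨c, hc⟩
  · obtain ⟨o, ho⟩ := hval i
    exact ⟨o, fun ws => by rw [ho ws, hi]⟩
  · exact ⟨Operand.var x, fun ws => by rw [hx]; rfl⟩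
  · exact ⟨Operand.const c, fun ws => by rw [hc]; rfl⟩

/-- Re-indexing (pre-composition) is free. [cite: Burgisser2000, Def. 2.1] -/
theorem precomp (h : JointlyComputed v s) (e : ι' → ι) : JointlyComputed (v ∘ e) s :=
  h.of_mem _ fun i' => Or.inl ⟨e i', rfl⟩

/-- **Every member of a jointly computed family has `complexity ≤ s`** (take the member's operand
as output). [cite: Burgisser2000, Def. 2.1] -/
theorem complexity_le (h : JointlyComputed v s) (i : ι) : complexity (v i) ≤ s := by
  obtain ⟨G, hfan, hlen, hval⟩ := h
  obtain ⟨o, ho⟩ := hval i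
  have hcomp : (⟨G, o⟩ : ArithCircuit k τ).Computes (v i) := by
    change o.eval (gateValues G) = v i
    have := ho []
    rwa [List.append_nil] at this
  exact (complexity_le_size (P := ⟨G, o⟩) (fun g hg => hfan g hg) hcomp).trans hlen

end JointlyComputed

/-- **Inputs are free**: a family of variables and constants is jointly computed within `0` gates.
[cite: Burgisser2000, Def. 2.1] -/
theorem jointlyComputed_of_inputs {ι : Type w} (w : ι → MvPolynomial τ k)
    (hw : ∀ i, (∃ x, w i = X x) ∨ ∃ c, w i = C c) : JointlyComputed w 0 := by
  refine ⟨[], fun g hg => by simp at hg, le_rfl, fun i => ?_⟩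
  rcases hw i with ⟨x, hx⟩ | ⟨c, hc⟩
  · exact ⟨Operand.var x, fun ws => by rw [hx]; rfl⟩
  · exact ⟨Operand.const c, fun ws => by rw [hc]; rfl⟩

namespace JointlyComputed

variable {ι : Type w} {v : ι → MvPolynomial τ k} {s : ℕ}

/-- **Appending one entry.** If `v` is jointly computed within `s` gates, then so is `v` together
with the new entry `F(X, v)` within `s + complexity F` gates: a minimal circuit for `F` is appended
with its inputs wired to the stable operands (`substCircuit`, `eval_substCircuit`); the old operands
stay stable (`gateValues_prefix`). This is the inductive step of `complexity_chain_le`.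
[cite: Burgisser2000, Rem. 2.7] -/
theorem extend₁ (h : JointlyComputed v s) (F : MvPolynomial (τ ⊕ ι) k) :
    JointlyComputed (Sum.elim v (fun _ : Unit => aeval (Sum.elim X v) F))
      (s + complexity F) := by
  classical
  obtain ⟨G, hfan, hlen, hval⟩ := h
  choose o ho using hval
  obtain ⟨P, hP2, hPc, hPs⟩ := exists_computes_size_eq_complexity F
  let ρ : τ ⊕ ι → Operand k τ := Sum.elim Operand.var o
  have hρ : ∀ i ws, (ρ i).eval (gateValues G ++ ws) = Sum.elim X v i := by
    rintro (x | i) ws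
    · rfl
    · exact ho i ws
  let Q : ArithCircuit k τ := P.substCircuit G ρ
  have hQeval : Q.eval = aeval (Sum.elim X v) F := by
    rw [eval_substCircuit P G hρ, hPc]
  have hQfan : Q.IsFanInTwo := IsFanInTwo.substCircuit hP2 hfan ρ
  obtain ⟨tl, htl⟩ := ArithCircuit.gateValues_prefix (k := k) G (P.gates.map (Gate.subst ρ G.length))
  refine ⟨Q.gates, hQfan, ?_, ?_⟩
  · change (G ++ P.gates.map (Gate.subst ρ G.length)).length ≤ s + complexity F
    rw [List.length_append, List.length_map, ← hPs]
    exact Nat.add_le_add_right hlen _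
  · rintro (i | u)
    · refine ⟨o i, fun ws => ?_⟩
      change (o i).eval (gateValues (G ++ P.gates.map (Gate.subst ρ G.length)) ++ ws) = v i
      rw [htl, List.append_assoc]
      exact ho i _
    · refine ⟨Q.output.truncate (gateValues Q.gates).length, fun ws => ?_⟩
      rw [Operand.eval_truncate_append]
      exact hQeval

/-- **Appending finitely many entries, `Fin m` form**: new entries `F j (X, v)` (`j < m`), each
reading only `v`, cost `Σ_j complexity (F j)` on top of `s`. [cite: Burgisser2000, Rem. 2.7] -/
theorem extend_fin (h : JointlyComputed v s) :
    ∀ (m : ℕ) (F : Fin m → MvPolynomial (τ ⊕ ι) k),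
      JointlyComputed (Sum.elim v (fun j : Fin m => aeval (Sum.elim X v) (F j)))
        (s + ∑ j : Fin m, complexity (F j))
  | 0, F => by
    rw [Finset.univ_eq_empty, Finset.sum_empty, Nat.add_zero]
    exact h.of_mem _ (by rintro (i | j); exacts [Or.inl ⟨i, rfl⟩, j.elim0])
  | m + 1, F => by
    have ih := extend_fin h m (fun j => F (Fin.castSucc j))
    -- append the last entry, renamed to read the enlarged family
    let F' : MvPolynomial (τ ⊕ (ι ⊕ Fin m)) k := rename (Sum.map id Sum.inl) (F (Fin.last m))
    have hfun : ((Sum.elim X (Sum.elim v (fun j : Fin m =>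
        aeval (Sum.elim X v) (F (Fin.castSucc j))))) ∘ Sum.map id Sum.inl :
        τ ⊕ ι → MvPolynomial τ k) = Sum.elim X v := by
      funext x
      rcases x with x | i <;> rfl
    have hF' : aeval (Sum.elim X (Sum.elim v (fun j : Fin m =>
        aeval (Sum.elim X v) (F (Fin.castSucc j))))) F' = aeval (Sum.elim X v) (F (Fin.last m)) := by
      simp only [F', aeval_rename, hfun]
    have hc : complexity F' = complexity (F (Fin.last m)) :=
      complexity_rename_of_injective_holds
        (Sum.map_injective.2 ⟨Function.injective_id, Sum.inl_injective⟩) _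
    have h2 := ih.extend₁ F'
    rw [hF', hc] at h2
    have hsum : s + ∑ j : Fin m, complexity (F (Fin.castSucc j)) + complexity (F (Fin.last m)) =
        s + ∑ j : Fin (m + 1), complexity (F j) := by
      rw [Fin.sum_univ_castSucc, Nat.add_assoc]
    rw [hsum] at h2
    refine h2.of_mem _ ?_
    rintro (i | j)
    · exact Or.inl ⟨Sum.inl (Sum.inl i), rfl⟩
    · refine Or.inl ?_
      rcases Fin.eq_castSucc_or_eq_last j with ⟨j', rfl⟩ | rfl
      · exact ⟨Sum.inl (Sum.inr j'), rfl⟩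
      · exact ⟨Sum.inr (), rfl⟩

/-- **Appending a finite family of entries** indexed by any `Fintype κ`: new entries `F j (X, v)`,
each reading only `v`, cost `Σ_j complexity (F j)` on top of `s`. [cite: Burgisser2000, Rem. 2.7] -/
theorem extend (h : JointlyComputed v s) {κ : Type w'} [Fintype κ]
    (F : κ → MvPolynomial (τ ⊕ ι) k) :
    JointlyComputed (Sum.elim v (fun j : κ => aeval (Sum.elim X v) (F j)))
      (s + ∑ j : κ, complexity (F j)) := by
  classical
  let e := Fintype.equivFin κ
  have h1 := h.extend_fin (Fintype.card κ) (fun j => F (e.symm j))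
  have hsum : ∑ j : Fin (Fintype.card κ), complexity (F (e.symm j)) = ∑ j : κ, complexity (F j) :=
    Fintype.sum_equiv e.symm _ _ (fun _ => rfl)
  rw [hsum] at h1
  refine h1.of_mem _ ?_
  rintro (i | j)
  · exact Or.inl ⟨Sum.inl i, rfl⟩
  · refine Or.inl ⟨Sum.inr (e j), ?_⟩
    simp only [Sum.elim_inr, Equiv.symm_apply_apply]

/-- Appending a finite family with a uniform per-entry cost bound `c`: total `s + |κ| · c`.
[cite: Burgisser2000, Rem. 2.7] -/
theorem extend_le (h : JointlyComputed v s) {κ : Type w'} [Fintype κ]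
    (F : κ → MvPolynomial (τ ⊕ ι) k) {c : ℕ} (hc : ∀ j, complexity (F j) ≤ c) :
    JointlyComputed (Sum.elim v (fun j : κ => aeval (Sum.elim X v) (F j)))
      (s + Fintype.card κ * c) :=
  (h.extend F).mono (by
    have : ∑ j : κ, complexity (F j) ≤ ∑ _j : κ, c := Finset.sum_le_sum fun j _ => hc j
    rw [Finset.sum_const, Finset.card_univ, smul_eq_mul] at this
    omega)

end JointlyComputed

/-! ### One-gate steps -/

section OneGate

variable {σ : Type w}

/-- A weighted sum of two variables costs one gate: `L(a • X i + b • X j) ≤ 1`.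
[cite: Burgisser2000, Def. 2.1] -/
theorem complexity_wadd_X_le (a b : k) (i j : σ) :
    complexity (a • (X i : MvPolynomial σ k) + b • X j) ≤ 1 := by
  have h := complexity_wadd_le a b (X i : MvPolynomial σ k) (X j)
  rwa [complexity_X_holds, complexity_X_holds] at h

/-- A product of two variables costs one gate: `L(X i * X j) ≤ 1`. [cite: Burgisser2000, Def. 2.1] -/
theorem complexity_X_mul_X_le (i j : σ) :
    complexity ((X i : MvPolynomial σ k) * X j) ≤ 1 := by
  have h := complexity_mul_le_holds (X i : MvPolynomial σ k) (X j)
  rwa [complexity_X_holds, complexity_X_holds] at h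

/-- A scalar multiple of a variable costs one gate: `L(a • X i) ≤ 1`. [cite: Burgisser2000, Def. 2.1] -/
theorem complexity_smul_X_le (a : k) (i : σ) :
    complexity (a • (X i : MvPolynomial σ k)) ≤ 1 := by
  have h := complexity_smul_le_holds a (X i : MvPolynomial σ k)
  rwa [complexity_X_holds] at h

end OneGate

namespace JointlyComputed

variable {ι : Type w} {v : ι → MvPolynomial τ k} {s : ℕ}

/-- **Weighted additions**: appending the entries `a j • v (i₁ j) + b j • v (i₂ j)` (`j : κ`) costs
one gate each. [cite: Burgisser2000, Def. 2.1] -/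
theorem extend_wadd (h : JointlyComputed v s) {κ : Type w'} [Fintype κ] (a b : κ → k)
    (i₁ i₂ : κ → ι) :
    JointlyComputed (Sum.elim v (fun j : κ => a j • v (i₁ j) + b j • v (i₂ j)))
      (s + Fintype.card κ) := by
  have h1 := h.extend_le (fun j : κ => a j • (X (Sum.inr (i₁ j)) : MvPolynomial (τ ⊕ ι) k) +
      b j • X (Sum.inr (i₂ j))) (c := 1) (fun j => complexity_wadd_X_le _ _ _ _)
  rw [Nat.mul_one] at h1
  refine h1.of_mem _ ?_
  rintro (i | j)
  · exact Or.inl ⟨Sum.inl i, rfl⟩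
  · exact Or.inl ⟨Sum.inr j, by simp⟩

/-- **Products**: appending the entries `v (i₁ j) * v (i₂ j)` (`j : κ`) costs one gate each.
[cite: Burgisser2000, Def. 2.1] -/
theorem extend_mul (h : JointlyComputed v s) {κ : Type w'} [Fintype κ] (i₁ i₂ : κ → ι) :
    JointlyComputed (Sum.elim v (fun j : κ => v (i₁ j) * v (i₂ j))) (s + Fintype.card κ) := by
  have h1 := h.extend_le (fun j : κ => (X (Sum.inr (i₁ j)) : MvPolynomial (τ ⊕ ι) k) *
      X (Sum.inr (i₂ j))) (c := 1) (fun j => complexity_X_mul_X_le _ _)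
  rw [Nat.mul_one] at h1
  refine h1.of_mem _ ?_
  rintro (i | j)
  · exact Or.inl ⟨Sum.inl i, rfl⟩
  · exact Or.inl ⟨Sum.inr j, by simp⟩

/-- **Scalings**: appending the entries `a j • v (i₁ j)` (`j : κ`) costs one gate each.
[cite: Burgisser2000, Def. 2.1] -/
theorem extend_smul (h : JointlyComputed v s) {κ : Type w'} [Fintype κ] (a : κ → k)
    (i₁ : κ → ι) :
    JointlyComputed (Sum.elim v (fun j : κ => a j • v (i₁ j))) (s + Fintype.card κ) := by
  have h1 := h.extend_le (fun j : κ => a j • (X (Sum.inr (i₁ j)) : MvPolynomial (τ ⊕ ι) k))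
    (c := 1) (fun j => complexity_smul_X_le _ _)
  rw [Nat.mul_one] at h1
  refine h1.of_mem _ ?_
  rintro (i | j)
  · exact Or.inl ⟨Sum.inl i, rfl⟩
  · exact Or.inl ⟨Sum.inr j, by simp⟩

end JointlyComputed

end Literature.Computability.AlgebraicComplexity

end
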